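/-
Copyright (c) 2026 the pub-hodgecm-mathlib formalisation cell (harness21).  Prover seat hodgecm-mathlib-K2E3-p28 (g3) (E3 hand lent to strike line L1 by CHAIR K2-lead (g2)
VALVE WORD W4; CHAIR ACROSS-LINES VALVE 00:05:02Z → U1 desk K2E3-p14 (g9) «= (a) GO» 00:14:13Z), Track B «K2-LIT» ∕ hLiu418 = stmt-HodgeConjecture-24832: organ U1-CT-ind
stage 3 («U1-glob») LEVEL 2 — THE `obtain`-READY PACKAGE OF THE GLOBAL-TAIL SIDE AT THE KERNEL PLACE: ★ (o1) place letters ▸ ★ Φ3b carriers ▸ ★ B2b FILE 3 purity ▸ ★ `htail`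
(p863396), with the five LEVEL-2 data (`T, bT, rT, ν_∞, HT`) EXPORTED.  THEOREMS ONLY.
-/
import Summits.HodgeConjecture.HodgeConjecture.Theorems.K2LiuLocalKernelTailOfRecord            -- ★ p863396 (this seat): `smul_whittakerDelta_eq_loc_mul_rest_of_letters` (+ ★ FILE 2, ★ G1)
import Summits.HodgeConjecture.HodgeConjecture.Theorems.K2LiuStdSectionPlaceLettersOfRecord      -- ★ (o1) p863289 (this seat): `exists_placeLetters_of_isStandard` (+ ★ Φ3b via ★ (E3))
import Summits.HodgeConjecture.HodgeConjecture.Theorems.K2LiuStdExtensionPureAt                  -- ★ B2b FILE 3 p863166 (this seat): `exists_pureAt_placesEmbed_flat`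
import Summits.HodgeConjecture.HodgeConjecture.Theorems.K2LiuStdExtensionDatumMonotone             -- ★ (K2Liu-p13): `stdExtension_eq_of_le'` (`stdExtension 𝒦' = stdExtension 𝒦` for `𝒦.K ≤ 𝒦'.K`)
import HarnessLib

/-!
# Crux `HLiu418`, U1-glob LEVEL 2 — `K2LiuLocalKernelPlaceLettersAtKernelPlace`: THE GLOBAL-TAIL PACKAGE AT THE KERNEL PLACE `v₀`, `obtain`-READY
# `∃ T ∋ v₀, bT, rT, ν_∞, HT` with `bT` = the flat family of record through `b` AT THE ADAPTED DATUM `𝒦' ⊇ 𝒦`, `HT` = ★ FILE 2's `∞ × (T∖v₀)` head, and for ALL `(c, D, P, Fn)`: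
# `c • W_S(f_s)(h) = Fn(s) · ((c:ℂ) · HT(s,h) · [ζ^{T}(2s)∕(ζ^{T}(2s+1)·L^{T}(2s+2,ε))] · ∏_{v∈D} P_v(s))` on `{n∕2 < re s}`   [KudlaRallis1994 §2; Tan1999 §3–§4]

Cell `hodgecm-mathlib`, crux item hLiu418 = `stmt-HodgeConjecture-24832`; squad K2, strike line L1; U1 desk K2E3-p14 (g9) (LEVEL 2 pen, the consumer of this package);
prover K2E3-p28 (g3).  Lane `--supports stmt-HodgeConjecture-24832 --as helper` (count-neutral).  THEOREMS ONLY (no `def`, no `instance`, no notation, no named-fact hypothesis,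
no `sorry`).  General frame `e : Fin N × Fin M ≃ Fin n` (`1 ≤ n`), general index `S`, general base parameter `s₀` (LEVEL 2: `s₀ = ½`, `S = S♭`, `n = 2`).

THE POINT (desk K2E3-p14 (g9) 00:14:13Z).  LEVEL 2's `htail` row is ★ `K2LiuLocalKernelTailOfRecord.smul_whittakerDelta_eq_loc_mul_rest_of_letters`, which takes ★ B2b FILE 2's letters
BY VALUE.  At the U1-glob data — `𝒦` STANDARD, `χ` unitary, `f := stdExtension 𝒦 s₀ φ` a `𝒦`-standard family with continuous members, `φ` PURE AT `v₀`
(`φ h = a (h·ι_{v₀}(h_{v₀})⁻¹) · b (h_{v₀})`, `b ∈ I_{v₀}(s₀, χ_{v₀})`), an index `S`, a point `h`, a Haar `νN` on `N_Δ(𝔸)`, the desk's FIXED local carriers `νv` pinned off `TK`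
and the level guard `(𝒦'.K)_v ⊆ K_{H,v}` off `TK𝒦'` for the adapted datum — every one of those letters is ★: (o1) ★ `exists_placeLetters_of_isStandard` (`hχ hfac hh hw hS` off `T₀`), ★ Φ3b
`exists_isHaarMeasure_map_unipDeltaSplit_eq_prod_pi_rpMeasure` (`ν_∞`, `hmap` for the desk's `νv`), ★ B2b FILE 3 `exists_pureAt_placesEmbed_flat` (`bT rT hpure` + the flat-family
letters of `bT`).  This file RUNS the three `obtain`s once at `T := ((T₀ ∪ TK) ∪ TK𝒦') ∪ {v₀}` — ★ (o1) at `𝒦` (where `f` is standard), ★ FILE 3 at the LARGER `v₀`-ADAPTED standard datum `𝒦'` (`𝒦.K ≤ 𝒦'.K`: desk 00:23:38Z junction fix — LEVEL 2's compact open `K₀` has `ι_{v₀}(K₀) ⊆ 𝒦'.K`, and ★ `stdExtension_eq_of_le'` makes the two families equal) — and EXPORTS what LEVEL 2 must name — `T ∋ v₀`, `bT` (with ★ FILE 3's (ii)–(vi):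
Siegel law at every `s`, smooth, flat on `ι_{v₀}⁻¹(𝒦'.K)`, `bT s₀ = b`, the height-twist formula with `𝒦'.pPart` — so TailGlue §5 ∕ FILE B act on THE SAME local family), `rT`, `ν_∞` (as data) and
the head `HT` (an `rfl`-clause `hHT` giving ★ FILE 2's `∞ × (T∖v₀)` bracket head, so ★ `exists_Gc_of_placeLetters_scalarK1_cm_pure`'s `hsplit` is read off it), and — box
K2E5-r02 (g7) 00:31:08Z (vii)–(x) — `ν_∞` Haar and σ-finite, `hpure` (the head `f ∘ placesEmbed_T` is `bT ⊗ rT`) and the EXPLICIT formula of `rT` (★ FILE 3 §1's witness: the height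
twist of the away-factor `a` at `y[v₀ ↦ 1]`), so FILE A can run ★ `head_eq_archFactor_mul_prod_of_pureTensor` on `HT` — followed by the
identity for ALL later letters `(c, D, hDT, P, hP1, hI, Fn, hloc)` (universally quantified AFTER the `∃`, since they mention `T`):
* §1 **`exists_kernelPlace_tailPackage`**.
References: [KudlaRallis1994] §2 (2.10)–(2.12); [Tan1999] §1 p. 166, §3, §4 Prop. 4.8; [BorelJacquet1979] §4.1; [CasselsFrohlichANT1967] Ch. XV (Tate) Thm. 3.3.1.
HONEST LABEL.  Count-neutral helper (pure `obtain` plumbing, zero new mathematics): `HC_CM` is proved only modulo the 7 printed citations (2 remaining named inputs: hLiu418 =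
`stmt-HodgeConjecture-24832`, h413 = `stmt-HodgeConjecture-24833`) until rung 0 closes; LEVEL 2 stays OPEN (`Fn`∕`hN₃` side: TailGlue, FILE B; (K1a-3) local faces).
-/

set_option autoImplicit false
set_option linter.dupNamespace false -- the mandated namespace repeats `HodgeConjecture.HodgeConjecture`

noncomputable section

open scoped Matrix RestrictedProduct ENNReal NNReal Topology ComplexConjugate
open NumberField IsDedekindDomain MeasureTheory Measure Filter Set

namespace Summit.HodgeConjecture.HodgeConjecture.Cruxes.HLiu418.K2LiuLocalKernelPlaceLettersAtKernelPlace

open Literature.NumberTheory.Automorphic Literature.NumberTheory.LFunctions Literature.NumberTheory.GaloisRepresentations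
open Literature.NumberTheory.GelbartRogawski1991 Literature.NumberTheory.GelbartRogawski1991.GRConstruction
open Literature.NumberTheory.GelbartRogawski1991.UnitaryDualPair
open Literature.NumberTheory.K2Lit.SiegelDoubled Literature.NumberTheory.K2Lit.LocalSiegelDoubled
open Literature.NumberTheory.K2Lit.PlaceSplitting
open Literature.MeasureTheory.RestrictedProduct
open Literature.Topology.Algebra.RestrictedProduct (inH)
open Summit.HodgeConjecture.HodgeConjecture.Cruxes.HLiu418.K2LiuSiegelUnipotentLocalDefs
open Summit.HodgeConjecture.HodgeConjecture.Cruxes.HLiu418.K2LiuSiegelUnipotentSplitDefs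
open Summit.HodgeConjecture.HodgeConjecture.Cruxes.HLiu418.K2LiuSiegelUnipotentSplitAtDefs
open Summit.HodgeConjecture.HodgeConjecture.Cruxes.HLiu418.K2LiuSiegelUnipotentFourierDefs
open Summit.HodgeConjecture.HodgeConjecture.Cruxes.HLiu418.K2LiuSiegelUnipotentHaarPinned (exists_isHaarMeasure_map_unipDeltaSplit_eq_prod_pi_rpMeasure)
open Summit.HodgeConjecture.HodgeConjecture.Cruxes.HLiu418.K2LiuLocalKernelTailOfRecord (smul_whittakerDelta_eq_loc_mul_rest_of_letters)
open Summit.HodgeConjecture.HodgeConjecture.Cruxes.HLiu418.K2LiuStdSectionPlaceLettersOfRecord (exists_placeLetters_of_isStandard)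
open Summit.HodgeConjecture.HodgeConjecture.Cruxes.HLiu418.K2LiuStdExtensionPureAt (stdExtension_placesEmbed_eq_mul_of_pureAt)
open Summit.HodgeConjecture.HodgeConjecture.Cruxes.HLiu418.K2LiuStdFamilyAwayPurityFlat (heightTwistLoc_siegel heightTwistLoc_smooth)
open Summit.HodgeConjecture.HodgeConjecture.Cruxes.HLiu418.K2LiuIwasawaDeltaUnimodular (IwasawaDatum.modDelta_eq_one_of_mem)
open Summit.HodgeConjecture.HodgeConjecture.Cruxes.HLiu418.K2LiuStdExtensionDatumMonotone (stdExtension_eq_of_le')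

variable (L : Type) [Field L] [NumberField L] [IsCMField L]
variable {N M n : ℕ} (e : Fin N × Fin M ≃ Fin n)
  (dV : Fin N → L) (hdV : ∀ i, IsCMField.complexConj L (dV i) = dV i)
  (dW : Fin M → L) (hdW : ∀ i, IsCMField.complexConj L (dW i) = dW i)
  [DecidableEq (HeightOneSpectrum (𝓞 (Fp L)))]
  [MeasurableSpace ↥(unipDelta L e dV hdV dW hdW)] [BorelSpace ↥(unipDelta L e dV hdV dW hdW)]
  [MeasurableSpace ↥(unipDeltaArch L e dV hdV dW hdW)] [BorelSpace ↥(unipDeltaArch L e dV hdV dW hdW)]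
  [∀ v : HeightOneSpectrum (𝓞 (Fp L)), MeasurableSpace ↥(unipDeltaLoc L e dV hdV dW hdW v)] [∀ v : HeightOneSpectrum (𝓞 (Fp L)), BorelSpace ↥(unipDeltaLoc L e dV hdV dW hdW v)]

/-! ## §1 The package -/

set_option maxHeartbeats 2400000 in -- MEASURED: `whnf` of the STATEMENT fails at 1 600 000, passes at 2 400 000 (★ p863396's 1 200 000 telescope under the 6-fold `∃`, + ★ FILE 3's letters, `hHT`, and box r02's exports (vii)–(x): `hpure` + the `rT` formula); below ★ F4a∕F4b's measured 4 000 000; proof is `obtain`∕`rw`∕`exact` only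
/-- **THE GLOBAL-TAIL PACKAGE AT THE KERNEL PLACE (LEVEL 2's `obtain`).**  `𝒦 ≤ 𝒦'` standard Iwasawa data (`𝒦.K ≤ 𝒦'.K`) with `(𝒦'.K)_v ⊆ K_{H,v}` off `TK𝒦'`; `χ` unitary;
`f := stdExtension 𝒦 s₀ φ` `𝒦`-standard with continuous members; `φ` pure at `v₀` through `(a, b)`, `b ∈ I_{v₀}(s₀, χ_{v₀})`; `S`, `h`; Haar `νN`; local carriers `νv` pinned off `TK`.
THEN `∃ T ∋ v₀` (`TK ∪ TK𝒦' ⊆ T`), `bT` = the flat family through `b` at `𝒦'` (★ FILE 3 (ii)–(vi): flat on `ι_{v₀}⁻¹(𝒦'.K)`), `rT`, `ν_∞`, `HT` = ★ FILE 2's `∞ × (T∖v₀)` head (`hHT`),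
such that for ALL scalars `c`, collapse letters `(D, P, hI)` and local readings `(Fn, hloc)`:
`c • W_S(f_s)(h) = Fn s · ((c:ℂ) · HT s h · [ζ^{↑T}(2s)∕(ζ^{↑T}(2s+1)·L^{↑T}(2s+2,ε))] · ∏_{v∈D} P_v(s))` on `{n∕2 < re s}`. [cite: KudlaRallis1994, §2] [cite: Tan1999, §1 p. 166; §4 Prop. 4.8]
[cite: BorelJacquet1979, §4.1] [cite: CasselsFrohlichANT1967, Ch. XV (Tate) Thm. 3.3.1] -/
theorem exists_kernelPlace_tailPackage (hdV0 : ∀ i, dV i ≠ 0) (hdW0 : ∀ i, dW i ≠ 0) (hn : 1 ≤ n)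
    {𝒦 𝒦' : IwasawaDatum L e dV hdV dW hdW} (h𝒦 : 𝒦.IsStd) (h𝒦' : 𝒦'.IsStd) (hle : 𝒦.K ≤ 𝒦'.K)
    (TK𝒦' : Finset (HeightOneSpectrum (𝓞 (Fp L))))
    (hKT' : ∀ k ∈ 𝒦'.K, ∀ v, v ∉ TK𝒦' → UnitaryGroup.evalPlace (Fp L) L (IsCMField.complexConj L) (n + n) (hermD L e dV hdV dW hdW) v (UnitaryGroup.finPart (Fp L) L (IsCMField.complexConj L) (n + n) (hermD L e dV hdV dW hdW) k) ∈ UnitaryGroup.localInt L (IsCMField.complexConj L) (n + n) (hermD L e dV hdV dW hdW) v)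
    {χ : HeckeCharacter L} (hχu : χ.IsUnitary) (s₀ : ℂ) {φ a : HA L e dV hdV dW hdW → ℂ}
    (hstd : IsStandardSectionFamily 𝒦 χ (stdExtension 𝒦 s₀ φ)) (hcont : ∀ s, Continuous (stdExtension 𝒦 s₀ φ s))
    (v₀ : HeightOneSpectrum (𝓞 (Fp L))) {b : UnitaryGroup.localPi L (IsCMField.complexConj L) (n + n) (hermD L e dV hdV dW hdW) v₀ → ℂ}
    (hb : b ∈ localDegPS (Fp L) L (IsCMField.complexConj L) (complexConj_imagUnit L) (imagUnit_ne_zero L) (imagUnit_mul_self L)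
          v₀ n (gramR_isSymm L e dV hdV dW hdW) (hermD_eq_map_gramD L e dV hdV dW hdW) (fun w => χ.localComponent w.1) s₀)
    (hφ : ∀ h : HA L e dV hdV dW hdW,
      φ h = a (h * (locToAdelic L e dV hdV dW hdW v₀ (UnitaryGroup.evalPlace (Fp L) L (IsCMField.complexConj L) (n + n) (hermD L e dV hdV dW hdW) v₀ (UnitaryGroup.finPart (Fp L) L (IsCMField.complexConj L) (n + n) (hermD L e dV hdV dW hdW) h)))⁻¹) *
        b (UnitaryGroup.evalPlace (Fp L) L (IsCMField.complexConj L) (n + n) (hermD L e dV hdV dW hdW) v₀ (UnitaryGroup.finPart (Fp L) L (IsCMField.complexConj L) (n + n) (hermD L e dV hdV dW hdW) h)))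
    (S : Matrix (Fin n) (Fin n) L) (h : HA L e dV hdV dW hdW)
    (νN : Measure ↥(unipDelta L e dV hdV dW hdW)) [νN.IsHaarMeasure]
    (νv : ∀ v : HeightOneSpectrum (𝓞 (Fp L)), Measure ↥(unipDeltaLoc L e dV hdV dW hdW v)) [∀ v, (νv v).IsHaarMeasure] [∀ v, SigmaFinite (νv v)]
    (TK : Finset (HeightOneSpectrum (𝓞 (Fp L))))
    (hνK : ∀ v, v ∉ TK → νv v (((inH (fun v => UnitaryGroup.localInt L (IsCMField.complexConj L) (n + n) (hermD L e dV hdV dW hdW) v) (fun v => unipDeltaLoc L e dV hdV dW hdW v) v) : Subgroup ↥(unipDeltaLoc L e dV hdV dW hdW v)) : Set ↥(unipDeltaLoc L e dV hdV dW hdW v)) = 1) :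
    ∃ (T : Finset (HeightOneSpectrum (𝓞 (Fp L)))) (hv₀ : v₀ ∈ T)
      (bT : ℂ → UnitaryGroup.localPi L (IsCMField.complexConj L) (n + n) (hermD L e dV hdV dW hdW) v₀ → ℂ)
      (rT : ℂ → UnitaryGroup.arch (Fp L) L (IsCMField.complexConj L) (n + n) (hermD L e dV hdV dW hdW) ×
        (Π w : {w : T // w ≠ ⟨v₀, hv₀⟩}, UnitaryGroup.localPi L (IsCMField.complexConj L) (n + n) (hermD L e dV hdV dW hdW) w.1.1) → ℂ)
      (νinf : Measure ↥(unipDeltaArch L e dV hdV dW hdW)) (HT : ℂ → HA L e dV hdV dW hdW → ℂ),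
      TK ∪ TK𝒦' ⊆ T ∧
      (∀ s : ℂ, Literature.NumberTheory.K2Lit.LocalSiegelDoubled.IsLocalSiegelSection (Fp L) L (IsCMField.complexConj L) (complexConj_imagUnit L) (imagUnit_ne_zero L)
          (imagUnit_mul_self L) v₀ n (gramR_isSymm L e dV hdV dW hdW) (hermD_eq_map_gramD L e dV hdV dW hdW) (fun w => χ.localComponent w.1) s (bT s)) ∧
      (∀ s : ℂ, Literature.NumberTheory.K2Lit.LocalSiegelDoubled.IsSmooth (Fp L) L (IsCMField.complexConj L) v₀ n (bT s)) ∧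
      (∀ (s s' : ℂ) (k : UnitaryGroup.localPi L (IsCMField.complexConj L) (n + n) (hermD L e dV hdV dW hdW) v₀),
        locToAdelic L e dV hdV dW hdW v₀ k ∈ 𝒦'.K → bT s k = bT s' k) ∧
      bT s₀ = b ∧
      (∀ (s : ℂ) (u : UnitaryGroup.localPi L (IsCMField.complexConj L) (n + n) (hermD L e dV hdV dW hdW) v₀),
        bT s u = ((modDelta L e dV hdV dW hdW (𝒦'.pPart (locToAdelic L e dV hdV dW hdW v₀ u)) : ℝ) : ℂ) ^ (2 * (s - s₀)) * b u) ∧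
      νinf.IsHaarMeasure ∧ SigmaFinite νinf ∧
      (∀ (s : ℂ) (yi : UnitaryGroup.arch (Fp L) L (IsCMField.complexConj L) (n + n) (hermD L e dV hdV dW hdW))
          (y : Π v : T, UnitaryGroup.localPi L (IsCMField.complexConj L) (n + n) (hermD L e dV hdV dW hdW) v.1),
        stdExtension 𝒦 s₀ φ s (placesEmbed L (hermD L e dV hdV dW hdW) T (yi, y)) = bT s (y ⟨v₀, hv₀⟩) * rT s (yi, fun w : {w : T // w ≠ ⟨v₀, hv₀⟩} => y w.1)) ∧
      (∀ (s : ℂ) (z : UnitaryGroup.arch (Fp L) L (IsCMField.complexConj L) (n + n) (hermD L e dV hdV dW hdW) ×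
          (Π w : {w : T // w ≠ ⟨v₀, hv₀⟩}, UnitaryGroup.localPi L (IsCMField.complexConj L) (n + n) (hermD L e dV hdV dW hdW) w.1.1)),
        rT s z = ((modDelta L e dV hdV dW hdW (𝒦'.pPart (placesEmbed L (hermD L e dV hdV dW hdW) T
              (z.1, fun v : T => if hv : v = ⟨v₀, hv₀⟩ then (1 : UnitaryGroup.localPi L (IsCMField.complexConj L) (n + n) (hermD L e dV hdV dW hdW) v.1) else z.2 ⟨v, hv⟩))) : ℝ) : ℂ) ^ (2 * (s - s₀)) *
          a (placesEmbed L (hermD L e dV hdV dW hdW) T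
              (z.1, fun v : T => if hv : v = ⟨v₀, hv₀⟩ then (1 : UnitaryGroup.localPi L (IsCMField.complexConj L) (n + n) (hermD L e dV hdV dW hdW) v.1) else z.2 ⟨v, hv⟩))) ∧
      (∀ (s : ℂ) (h' : HA L e dV hdV dW hdW), HT s h' =
        ∫ p, (conj (unipDeltaChar L e dV hdV dW hdW S
                (UnitaryGroup.archToAdelic (Fp L) L (IsCMField.complexConj L) (n + n) (hermD L e dV hdV dW hdW)
                  (p.1 : UnitaryGroup.arch (Fp L) L (IsCMField.complexConj L) (n + n) (hermD L e dV hdV dW hdW))) : ℂ) *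
              ∏ w : {w : T // w ≠ ⟨v₀, hv₀⟩}, conj (unipDeltaChar L e dV hdV dW hdW S
                (locToAdelic L e dV hdV dW hdW w.1.1
                  ((p.2 w : ↥(unipDeltaLoc L e dV hdV dW hdW w.1.1)) : UnitaryGroup.localPi L (IsCMField.complexConj L) (n + n) (hermD L e dV hdV dW hdW) w.1.1)) : ℂ)) *
            rT s (UnitaryGroup.archPart (Fp L) L (IsCMField.complexConj L) (n + n) (hermD L e dV hdV dW hdW) (weylDelta L e dV hdV dW hdW) *
                  (p.1 : UnitaryGroup.arch (Fp L) L (IsCMField.complexConj L) (n + n) (hermD L e dV hdV dW hdW)) *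
                  UnitaryGroup.archPart (Fp L) L (IsCMField.complexConj L) (n + n) (hermD L e dV hdV dW hdW) h',
                fun w : {w : T // w ≠ ⟨v₀, hv₀⟩} => UnitaryGroup.evalPlace (Fp L) L (IsCMField.complexConj L) (n + n) (hermD L e dV hdV dW hdW) w.1.1
                    (UnitaryGroup.finPart (Fp L) L (IsCMField.complexConj L) (n + n) (hermD L e dV hdV dW hdW) (weylDelta L e dV hdV dW hdW)) *
                  ((p.2 w : ↥(unipDeltaLoc L e dV hdV dW hdW w.1.1)) : UnitaryGroup.localPi L (IsCMField.complexConj L) (n + n) (hermD L e dV hdV dW hdW) w.1.1) *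
                  UnitaryGroup.evalPlace (Fp L) L (IsCMField.complexConj L) (n + n) (hermD L e dV hdV dW hdW) w.1.1
                    (UnitaryGroup.finPart (Fp L) L (IsCMField.complexConj L) (n + n) (hermD L e dV hdV dW hdW) h'))
          ∂(νinf.prod (Measure.pi fun w : {w : T // w ≠ ⟨v₀, hv₀⟩} => νv w.1.1))) ∧
      ∀ (c : ℝ) (D : Finset (HeightOneSpectrum (𝓞 (Fp L)))) (_hDT : ∀ v ∈ D, v ∉ T) (P : HeightOneSpectrum (𝓞 (Fp L)) → ℂ → ℂ)
        (_hP1 : ∀ v, v ∉ T → v ∉ D → ∀ s : ℂ, P v s = 1)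
        (_hI : ∀ s : ℂ, (n : ℝ) / 2 < s.re → ∀ v : {v : HeightOneSpectrum (𝓞 (Fp L)) // v ∉ T},
          ∫ y, conj (unipDeltaChar L e dV hdV dW hdW S
                (locToAdelic L e dV hdV dW hdW v.1 (y : UnitaryGroup.localPi L (IsCMField.complexConj L) (n + n) (hermD L e dV hdV dW hdW) v.1)) : ℂ) *
              LambdaLoc L e dV hdV dW hdW v.1 χ s
                (UnitaryGroup.evalPlace (Fp L) L (IsCMField.complexConj L) (n + n) (hermD L e dV hdV dW hdW) v.1
                    (UnitaryGroup.finPart (Fp L) L (IsCMField.complexConj L) (n + n) (hermD L e dV hdV dW hdW) (weylDelta L e dV hdV dW hdW)) *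
                  (y : UnitaryGroup.localPi L (IsCMField.complexConj L) (n + n) (hermD L e dV hdV dW hdW) v.1)) ∂(νv v.1) =
            ((1 - (v.1.residueCard : ℂ) ^ (-(2 * s + 1))) *
                (1 - (quadraticHeckeCharCM L).valueAtUniformizer v.1 * (v.1.residueCard : ℂ) ^ (-(2 * s + 2)))) /
              (1 - (v.1.residueCard : ℂ) ^ (-(2 * s))) * P v.1 s)
        (Fn : ℂ → ℂ)
        (_hloc : ∀ s : ℂ, (n : ℝ) / 2 < s.re →
          ∫ y, conj (unipDeltaChar L e dV hdV dW hdW S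
                (locToAdelic L e dV hdV dW hdW v₀ (y : UnitaryGroup.localPi L (IsCMField.complexConj L) (n + n) (hermD L e dV hdV dW hdW) v₀)) : ℂ) *
              bT s (UnitaryGroup.evalPlace (Fp L) L (IsCMField.complexConj L) (n + n) (hermD L e dV hdV dW hdW) v₀
                    (UnitaryGroup.finPart (Fp L) L (IsCMField.complexConj L) (n + n) (hermD L e dV hdV dW hdW) (weylDelta L e dV hdV dW hdW)) *
                  (y : UnitaryGroup.localPi L (IsCMField.complexConj L) (n + n) (hermD L e dV hdV dW hdW) v₀) *
                  UnitaryGroup.evalPlace (Fp L) L (IsCMField.complexConj L) (n + n) (hermD L e dV hdV dW hdW) v₀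
                    (UnitaryGroup.finPart (Fp L) L (IsCMField.complexConj L) (n + n) (hermD L e dV hdV dW hdW) h)) ∂(νv v₀) = Fn s),
        ∀ s : ℂ, (n : ℝ) / 2 < s.re →
          c • whittakerDelta L e dV hdV dW hdW νN S (stdExtension 𝒦 s₀ φ s) h =
            Fn s *
              ((c : ℂ) * HT s h *
                (partialStandardL (↑T : Set (HeightOneSpectrum (𝓞 (Fp L)))) (fun _ => {1}) (2 * s) /
                  (partialStandardL (↑T : Set (HeightOneSpectrum (𝓞 (Fp L)))) (fun _ => {1}) (2 * s + 1) *
                    partialStandardL (↑T : Set (HeightOneSpectrum (𝓞 (Fp L)))) (fun v => {(quadraticHeckeCharCM L).valueAtUniformizer v}) (2 * s + 2))) *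
                ∏ v ∈ D, P v s) := by
  -- ★ (o1): the five data letters off `T₀`; the place set of record `T := ((T₀ ∪ TK) ∪ TK𝒦') ∪ {v₀}`
  obtain ⟨T₀, hT₀⟩ := exists_placeLetters_of_isStandard L e dV hdV dW hdW hdV0 hdW0 h𝒦 hstd hcont h S
  set T : Finset (HeightOneSpectrum (𝓞 (Fp L))) := ((T₀ ∪ TK) ∪ TK𝒦') ∪ {v₀} with hTdef
  have hv₀ : v₀ ∈ T := Finset.mem_union_right _ (Finset.mem_singleton_self v₀)
  have hT₀T : T₀ ⊆ T := fun v hv => Finset.mem_union_left _ (Finset.mem_union_left _ (Finset.mem_union_left _ hv))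
  have hTKT : TK ⊆ T := fun v hv => Finset.mem_union_left _ (Finset.mem_union_left _ (Finset.mem_union_right _ hv))
  have hTK𝒦T : TK𝒦' ⊆ T := fun v hv => Finset.mem_union_left _ (Finset.mem_union_right _ hv)
  obtain ⟨hχT, hfac, hhT, hwT, hST⟩ := hT₀ T hT₀T
  have hνKT : ∀ v, v ∉ T → νv v (((inH (fun v => UnitaryGroup.localInt L (IsCMField.complexConj L) (n + n) (hermD L e dV hdV dW hdW) v) (fun v => unipDeltaLoc L e dV hdV dW hdW v) v) : Subgroup ↥(unipDeltaLoc L e dV hdV dW hdW v)) : Set ↥(unipDeltaLoc L e dV hdV dW hdW v)) = 1 :=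
    fun v hv => hνK v fun h' => hv (hTKT h')
  have hKT'T : ∀ k ∈ 𝒦'.K, ∀ v, v ∉ T → UnitaryGroup.evalPlace (Fp L) L (IsCMField.complexConj L) (n + n) (hermD L e dV hdV dW hdW) v (UnitaryGroup.finPart (Fp L) L (IsCMField.complexConj L) (n + n) (hermD L e dV hdV dW hdW) k) ∈ UnitaryGroup.localInt L (IsCMField.complexConj L) (n + n) (hermD L e dV hdV dW hdW) v :=
    fun k hk v hv => hKT' k hk v fun h' => hv (hTK𝒦T h')
  -- ★ Φ3b: the archimedean carrier for the desk's `νv`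
  obtain ⟨νinf, hνinf, hσ, hmap⟩ := exists_isHaarMeasure_map_unipDeltaSplit_eq_prod_pi_rpMeasure L e dV hdV dW hdW T νN νv hνKT
  haveI := hνinf
  haveI := hσ
  -- ★ B2b FILE 3: the head family is pure at `v₀`, with `bT` the flat family through `b`
  -- ★ B2b FILE 3 §1 at the LARGER `v₀`-adapted standard datum `𝒦'` (whose `ι_{v₀}⁻¹(𝒦'.K)` carries LEVEL 2's compact open `K₀`), with EXPLICIT `bT`, `rT`
  -- (★ (E6′)'s height twists), bridged to `𝒦` by ★ `stdExtension_eq_of_le'`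
  have hK' : 𝒦'.IsDeltaUnimodular := IwasawaDatum.modDelta_eq_one_of_mem L e dV hdV hdV0 dW hdW hdW0 𝒦'
  -- name the two explicit families as elements (cheap unification downstream; ★ (E6)'s naming discipline)
  obtain ⟨bT, hbT⟩ : ∃ bT : ℂ → UnitaryGroup.localPi L (IsCMField.complexConj L) (n + n) (hermD L e dV hdV dW hdW) v₀ → ℂ,
      bT = fun s u => ((modDelta L e dV hdV dW hdW (𝒦'.pPart (locToAdelic L e dV hdV dW hdW v₀ u)) : ℝ) : ℂ) ^ (2 * (s - s₀)) * b u := ⟨_, rfl⟩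
  obtain ⟨rT, hrT⟩ : ∃ rT : ℂ → UnitaryGroup.arch (Fp L) L (IsCMField.complexConj L) (n + n) (hermD L e dV hdV dW hdW) ×
        (Π w : {w : T // w ≠ ⟨v₀, hv₀⟩}, UnitaryGroup.localPi L (IsCMField.complexConj L) (n + n) (hermD L e dV hdV dW hdW) w.1.1) → ℂ,
      rT = fun s z => ((modDelta L e dV hdV dW hdW (𝒦'.pPart (placesEmbed L (hermD L e dV hdV dW hdW) T
          (z.1, fun v : T => if hv : v = ⟨v₀, hv₀⟩ then (1 : UnitaryGroup.localPi L (IsCMField.complexConj L) (n + n) (hermD L e dV hdV dW hdW) v.1) else z.2 ⟨v, hv⟩))) : ℝ) : ℂ) ^ (2 * (s - s₀)) *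
        a (placesEmbed L (hermD L e dV hdV dW hdW) T
          (z.1, fun v : T => if hv : v = ⟨v₀, hv₀⟩ then (1 : UnitaryGroup.localPi L (IsCMField.complexConj L) (n + n) (hermD L e dV hdV dW hdW) v.1) else z.2 ⟨v, hv⟩)) := ⟨_, rfl⟩
  have hpure : ∀ (s : ℂ) (yi : UnitaryGroup.arch (Fp L) L (IsCMField.complexConj L) (n + n) (hermD L e dV hdV dW hdW))
      (y : Π v : T, UnitaryGroup.localPi L (IsCMField.complexConj L) (n + n) (hermD L e dV hdV dW hdW) v.1),
      stdExtension 𝒦 s₀ φ s (placesEmbed L (hermD L e dV hdV dW hdW) T (yi, y)) = bT s (y ⟨v₀, hv₀⟩) * rT s (yi, fun w : {w : T // w ≠ ⟨v₀, hv₀⟩} => y w.1) :=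
    fun s yi y => by
      rw [hbT, hrT, ← stdExtension_eq_of_le' hdV0 hdW0 hle s₀ φ]
      exact stdExtension_placesEmbed_eq_mul_of_pureAt L e dV hdV hdV0 dW hdW hdW0 T h𝒦' hKT'T ⟨v₀, hv₀⟩ s₀ hφ s yi y
  have hSieg : ∀ s : ℂ, Literature.NumberTheory.K2Lit.LocalSiegelDoubled.IsLocalSiegelSection (Fp L) L (IsCMField.complexConj L) (complexConj_imagUnit L) (imagUnit_ne_zero L)
      (imagUnit_mul_self L) v₀ n (gramR_isSymm L e dV hdV dW hdW) (hermD_eq_map_gramD L e dV hdV dW hdW) (fun w => χ.localComponent w.1) s (bT s) := fun s => by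
    rw [hbT]; exact heightTwistLoc_siegel L e dV hdV hdV0 dW hdW hdW0 v₀ 𝒦' hb s
  have hsm : ∀ s : ℂ, Literature.NumberTheory.K2Lit.LocalSiegelDoubled.IsSmooth (Fp L) L (IsCMField.complexConj L) v₀ n (bT s) := fun s => by
    rw [hbT]; exact heightTwistLoc_smooth L e dV hdV hdV0 dW hdW hdW0 v₀ h𝒦' hb.2 _
  have hflat : ∀ (s s' : ℂ) (k : UnitaryGroup.localPi L (IsCMField.complexConj L) (n + n) (hermD L e dV hdV dW hdW) v₀),
      locToAdelic L e dV hdV dW hdW v₀ k ∈ 𝒦'.K → bT s k = bT s' k := fun s s' k hk => by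
    rw [hbT]
    show ((modDelta L e dV hdV dW hdW (𝒦'.pPart (locToAdelic L e dV hdV dW hdW v₀ k)) : ℝ) : ℂ) ^ (2 * (s - s₀)) * b k =
      ((modDelta L e dV hdV dW hdW (𝒦'.pPart (locToAdelic L e dV hdV dW hdW v₀ k)) : ℝ) : ℂ) ^ (2 * (s' - s₀)) * b k
    rw [IwasawaDatum.modDelta_pPart_of_mem_K hK' hk, Complex.ofReal_one, Complex.one_cpow, Complex.one_cpow]
  have hb0 : bT s₀ = b := by
    rw [hbT]; funext u
    show ((modDelta L e dV hdV dW hdW (𝒦'.pPart (locToAdelic L e dV hdV dW hdW v₀ u)) : ℝ) : ℂ) ^ (2 * (s₀ - s₀)) * b u = b u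
    rw [sub_self, mul_zero, Complex.cpow_zero, one_mul]
  refine ⟨T, hv₀, bT, rT, νinf, _, Finset.union_subset hTKT hTK𝒦T, hSieg, hsm, hflat, hb0, fun s u => by rw [hbT], hνinf, hσ, hpure,
    fun s z => by rw [hrT], fun s h' => rfl, ?_⟩
  intro c D hDT P hP1 hI Fn hloc s hs
  exact smul_whittakerDelta_eq_loc_mul_rest_of_letters L e dV hdV dW hdW T hdV0 hdW0 hn νN νv hνKT νinf hmap hχu hχT (fun s => hstd.1.1 s) hcont hfac
    ⟨v₀, hv₀⟩ bT rT hpure S hhT hwT hST c Fn hloc D hDT P hP1 hI s hs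

end Summit.HodgeConjecture.HodgeConjecture.Cruxes.HLiu418.K2LiuLocalKernelPlaceLettersAtKernelPlace

end
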